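import Literature.MathematicalPhysics.QuantumFieldTheory.Balaban1983to89.B7Prop3GeneralTild

/-!
# Bałaban's renormalization group for 4-d lattice Yang–Mills — B7 Proposition 3 AT A GENERAL BACKGROUND `V₀`, the LINEAR
PART, file 3: (115) exactly — the loop functional `A_x^{(1)}` split into `(R_{0,c₋}A)(Γ_{c₋,x}) + R(V₀(Γ_{c₋,x}))(R_{0,x}A)([x,x′])
− R(e^{iY_x})(R_{0,c₋}A)(c ∪ Γ_{c₊,x′})` — and (124) REGROUPED: the linear part «L(Q(V₀)A)_c» = the main term `L·(Q₀A)_c`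
(125) + three `[operator − 1]` DEFECT BRACKETS; the tree-contour terms cancel against the frame `−F̂_{V₀}(c₋)` exactly as at
the flat background (`B7Prop3GeneralLinearSplit`)

CITATION HEADER (lean-in-tree rule 2026-08-18).  Audit cell `pub-balaban`, sub-cell `t4` (NE7c ROUND-2 crew, seat
`b2b-balaban-t4-ne7c-formalise-leaf-05` gen 6; owner table `t4/b2b-balaban-t4-ne7c-p1/LEAVES-NE7c-P1.md` v2.3 row S55
«[B7] PROPOSITION 3 AT A GENERAL REGULAR BACKGROUND»; files 1–3 of the row: `B7Prop3GeneralRotated` p219571,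
`B7Prop3GeneralLinear` p219821, `B7Prop3GeneralTild`).  Source: T. Bałaban, *Averaging operations for lattice gauge
theories*, Commun. Math. Phys. **98**, 17–51 (1985) [Balaban1985Averaging] (cell paper B7; journal page = PDF page + 16),
Sect. D pp. 34–36 [PDF 18–20] ((115), (119)–(120), (124)–(125)), quoted from the page renders
`b2b-balaban-ref1/pages/1985-cmp98-averaging/1985-cmp98-averaging-p018-x2.png`, `-p019-x2.png`, `-p020-x2.png` READ AS
IMAGES by this seat (2026-08-20).
Companions (REUSED BY NAME, none modified): `B7Prop3GeneralRotated` (`tsum`, `tsum_append`, `conjR_mul_left`),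
`B7Prop3GeneralLinear` (`FhatCov`, `Q0cov`, `linQcov`), `B7Prop3GeneralTild` (`Aloop`, `DXavg`, `QprimeCov`, `linQcov_eq`),
`B7Prop1Explicit` (`hol`, `revWord`, `hol_revWord`, `disp_*`, `gammaWord`, `Wcx`, `Xavg`, `bavg`), `B7Prop3Flat` (`expCfg`),
`B7Eq78Linearization` (`conjR`), `B12AverageCorridor267` (`PhiY`).

THE PRINTED TEXT (verbatim from the renders).  p. 34 (115): "A_x = (R_{0,c₋}A)(Γ_{c,x}∪(−c)) + O(L²α₁²) = (R_{0,c₋}A)(Γ_{c₋,x}∪[x, x′])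
− R(e^{iY_x})(R_{0,c₋}A)(c∪Γ_{c₊,x′}) + O(L²α₁²)."  p. 35: "We can transform this linear expression using the identities
R(e^{iY_x}) = e^{i ad_{Y_x}} and g⁻¹(−i ad_{Y_x})e^{i ad_{Y_x}} = g⁻¹(i ad_{Y_x}). […] We have also (R_{0,c₋}A)(Γ_{c₊,x′}) =
R(V₀(c))(R_{0,c₊}A)(Γ_{c₊,x′}) = R(e^{−iY})R((V̄₀)_c)(R_{0,c₊}A)(Γ_{c₊,x′}) = e^{−i ad_Y}R̄_{0,c}(R_{0,c₊}A)(Γ_{c₊,x′})."; (120) as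
quoted in `B7Prop3GeneralLinear`.  p. 36 (124): "(Q(V₀)A)_c = Σ_{x∈B(c₋)} L^{−(d+1)}(R_{0,c₋}A)([x, x′]) + Σ_{x∈B(c₋)} L^{−(d+1)}
[g(−i ad_Y)g⁻¹(−i ad_{Y_x}) − 1](R_{0,c₋}A)(Γ_{c₋,x}) + Σ_{x∈B(c₋)} L^{−(d+1)}[g(−i ad_Y)g⁻¹(−i ad_{Y_x}) − 1]·(R_{0,c₋}A)([x, x′])
− Σ_{x∈B(c₋)} L^{−(d+1)}·[g(−i ad_Y)g⁻¹(i ad_{Y_x})e^{−i ad_Y} − 1]R̄_{0,c}(R_{0,c₊}A)(Γ_{c₊,x′}) + [e^{i ad_Y} − g(−i ad_Y) Σ_{x∈B(c₋)}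
L^{−d}g⁻¹(i ad_{Y_x})]L⁻¹(R_{0,c₋}A)(c). (124)  The first term on the right-hand side above is the main term in this linear form
[…] The remaining terms are small because the functions g(−z), g⁻¹(z), e^{iz} are equal to 1 for z = 0, so the operators occurring
in these terms can be estimated by O(L²α₀)"; (125): "(Q₀A)_c = (Q_{V₀}A)_c = Σ_{x∈B(c₋)} L^{−(d+1)}(R_{0,c₋}A)([x, x′])".

DICTIONARY (as in files 1–3; `X₀ := X_c(V₀)` = `iY`, `W_x` = `e^{iY_x}`, `Φ := PhiY X₀` = `g(−i ad_Y)`, `𝒜 := conjR (expUnit X₀)`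
= `e^{i ad_Y} = R(e^{iY})`, `R(W_x) = e^{i ad_{Y_x}}`, `Ψ_x(Z) := Dmlog W_x (Z W_x)` = `g⁻¹(−i ad_{Y_x})`, `R(V₀(c))` = `conjR (hol
V₀ q (seg κ L))`, `R̄_{0,c} = 𝒜 ∘ R(V₀(c))`).  THE REGROUPED FORM PROVED HERE (`linQcov_split`): «L(Q(V₀)A)_c» `= L·(Q₀A)_c +
[Φ(Σ_x L^{−d}Ψ_x(A_x^{(1)})) − Σ_x L^{−d}A_x^{(1)}] + [𝒜 − Σ_x L^{−d}R(W_x)]((R_{0,c₋}A)(c)) + Σ_x L^{−d}[𝒜 − R(W_x)]R(V₀(c))(R_{0,c₊}A)(Γ_{c₊,x′})`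
— print's (124) multiplied by `L`, with its second∕third∕fourth∕fifth terms COLLECTED DIFFERENTLY (by the place where the
operator defect acts rather than by the path piece): expanding `A_x^{(1)}` by (115) (`Aloop_eq`) inside the first bracket and
using `Σ_x L^{−d} = 1` recovers print's grouping term by term; every bracket is of the form `[operator − 1](path sum)` and
VANISHES when `Ψ_x = Φ = 𝒜 = R(W_x) = id` (flat loops), leaving the main term — the general-background form of
`B7Prop3Flat.frame_cancellation`.

WHAT THIS FILE PROVES (kernel, no `sorry`, standard axioms; the only hypothesis is `‖W_x(V₀) − 1‖ < 1` on `B(c₋)`, inherited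
from `linQcov_eq`; §1–§2 are pure identities):
* §1 `tstep_rev`, **`tsum_revWord`** (`(R_{0,x}A)(−Γ) = −R(V₀(Γ)⁻¹)(R_{0,y}A)(Γ)` — the linearised `V(−Γ) = V(Γ)⁻¹`).
* §2 `hol_gammaWord_eq` (`V₀(Γ_{c,x}) = V₀(Γ_{c₋,x})V₀([x,x′])V₀(Γ_{c₊,x′})⁻¹`), **`Aloop_eq`** — (115) EXACTLY for the first-order
  functional.
* §3 `sum_blockWeight` (`Σ_x L^{−d} = 1`), `sum_mainTerm` (the segment terms ARE `L·(Q₀A)_c`), `conjR_bavg` (`R̄_{0,c} =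
  𝒜∘R(V₀(c))`), `conjR_gammaWord` (`R(V₀(Γ_{c,x})) = R(W_x)∘R(V₀(c))`), `sum_Aloop_eq` ((115) summed: `Σ_x L^{−d}A_x^{(1)} =
  F̂_{V₀}(c₋) + L·(Q₀A)_c − …`), `conjR_bavg_FhatCov`, and **`linQcov_split`** — (124) REGROUPED.
ABSOLUTE-RULE LEDGER.  No `B7.Prop*` placeholder, no Literature `Prop`-fact, nothing of the manuscript cited as a fact; no new
definition.
NOT CERTIFIED HERE (the row's remaining work).  The BOUND (126) `|(Q(V₀)A)_c| ≤ (1 + O(1)L²α₀)|A|` — each bracket is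
`O(ε)·(path length)·|A|` for `‖W_x(V₀) − 1‖ ≤ ε` by `B12AverageCorridor267`'s `norm_PhiY_sub_one_le` ∕ `norm_AdU_expU_sub_one_le` ∕
`norm_PsiW_sub_one_le` (file 4 of the row); the term-by-term identification with print's grouping of (124); analyticity and (123).
DIVERGENCES from print.  (a) the regrouping (above); (b) everything ×`L` (print's (124) is for `(Q(V₀)A)_c = L⁻¹·`«L(Q(V₀)A)_c»);
(c) setting∕`log`∕`i`-absorption as in the lineage.
VALUE.  The algebraic heart of (124) — why the linear part of the curved-background double-bar average is the straight-segment
average `Q₀` up to `[operator − 1]` corrections — kernel-certified for the paper's own (89); NOT summit progress (NE7c NOT PROVED;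
spine PROVED 0∕9; rung (B)+1 on a finite T⁴ — NOT infinite volume, NOT mass gap, NOT Clay).
-/

noncomputable section

open scoped BigOperators
open NormedSpace Finset

namespace Literature.MathematicalPhysics.QuantumFieldTheory.Balaban1983to89.B7Prop3GeneralLinearSplit

open B7Prop1Explicit B7Prop3Flat B7Eq92Concrete MatrixLog B7Prop3GeneralRotated B7Prop3GeneralLinear
  B7Prop3GeneralTild
open B7Eq78Linearization (conjR conjR_apply conjR_add conjR_sub conjR_smul conjR_smul_real conjR_one)
open B12AverageCorridor267 (Dmlog PhiY)

-- `Site` alone would resolve to the torus sites of `Setup.lean`; re-export the `ℤ^d` sites of `B7Prop1Explicit`.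
export B7Prop1Explicit (Site)

variable {d : ℕ}

variable {𝔸 : Type*} [NormedRing 𝔸] [NormedAlgebra ℂ 𝔸] [NormOneClass 𝔸] [CompleteSpace 𝔸]
variable (L : ℕ)

/-! ## §1 Reversed contours: `(R_{0,·}A)(−Γ) = −R(V₀(Γ)⁻¹)(R_{0,·}A)(Γ)` -/

section Reversed

omit [NormedAlgebra ℂ 𝔸] [NormOneClass 𝔸] [CompleteSpace 𝔸] in
/-- `R(X)(−Y) = −R(X)Y` (private copy; the tree's `B8Eq146AExpansion.conjR_neg` is the same statement in a module not
imported here). [cite: Balaban1985Averaging, (56) p.27] -/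
private theorem conjR_neg (X : 𝔸ˣ) (Y : 𝔸) : conjR X (-Y) = -conjR X Y := by
  simp [conjR_apply]

omit [NormedAlgebra ℂ 𝔸] [NormOneClass 𝔸] [CompleteSpace 𝔸] in
/-- `R(X)0 = 0`. [cite: Balaban1985Averaging, (56) p.27] -/
private theorem conjR_zero (X : 𝔸ˣ) : conjR X (0 : 𝔸) = 0 := by
  simp [conjR_apply]

omit [NormedAlgebra ℂ 𝔸] [NormOneClass 𝔸] [CompleteSpace 𝔸] in
/-- `R(1) = id`. [cite: Balaban1985Averaging, (56) p.27] -/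
private theorem conjR_one_left (Y : 𝔸) : conjR (1 : 𝔸ˣ) Y = Y := by
  simp [conjR_apply]

omit [NormedAlgebra ℂ 𝔸] [NormOneClass 𝔸] [CompleteSpace 𝔸] in
/-- one letter reversed: traversing `b` backwards right after traversing it forwards contributes
`−R(V₀(b)⁻¹)·(contribution of b)` ((9) `U(−b) = U(b)⁻¹` linearised). [cite: Balaban1985Averaging, (9) p.18, (58) p.27] -/
theorem tstep_rev (V₀ : Site d → Fin d → 𝔸ˣ) (A : Site d → Fin d → 𝔸) (y : Site d) (l : Letter d) :
    tstep V₀ A (y + l.vec) l.rev = -conjR ((stepHol V₀ y l)⁻¹) (tstep V₀ A y l) := by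
  obtain ⟨μ, b⟩ := l
  cases b
  · -- `l = (μ, false)`, `l.rev = (μ, true)`: both sides are `A_b`, `b = ⟨y − e_μ, y⟩`
    have hv : Letter.vec ((μ, false) : Letter d) = -e μ := by simp [Letter.vec]
    simp only [tstep, Letter.rev, Bool.not_false, ↓reduceIte, Bool.false_eq_true, stepHol, conjR_apply, inv_inv, hv]
    simp only [mul_neg, neg_mul, neg_neg, ← mul_assoc, Units.mul_inv, one_mul, Units.mul_inv_cancel_right]
  · -- `l = (μ, true)`, `l.rev = (μ, false)`: both sides are `−R(V₀(b)⁻¹)A_b`, `b = ⟨y, y + e_μ⟩`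
    have hv : Letter.vec ((μ, true) : Letter d) = e μ := by simp [Letter.vec]
    have hv' : Letter.vec ((μ, false) : Letter d) = -e μ := by simp [Letter.vec]
    simp only [tstep, Letter.rev, Bool.not_true, Bool.false_eq_true, ↓reduceIte, stepHol, hv, hv',
      add_neg_cancel_right]

omit [NormedAlgebra ℂ 𝔸] [NormOneClass 𝔸] [CompleteSpace 𝔸] in
/-- **the reversed contour**: `(R_{0,x}A)(−Γ) = −R(V₀(Γ)⁻¹)·(R_{0,y}A)(Γ)` for `Γ` from `y` to `x` — the linearisation of
`V(−Γ) = V(Γ)⁻¹` (the derivative of the inverse), used in (115) for the returning pieces `−Γ_{c₊,x′}`, `−c` of the loop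
`Γ_{c,x} ∪ (−c)`. [cite: Balaban1985Averaging, (115) p.34, (9) p.18] -/
theorem tsum_revWord (V₀ : Site d → Fin d → 𝔸ˣ) (A : Site d → Fin d → 𝔸) :
    ∀ (y : Site d) (w : List (Letter d)),
      tsum V₀ A (y + disp w) (revWord w) = -conjR ((hol V₀ y w)⁻¹) (tsum V₀ A y w)
  | y, [] => by simp [conjR_apply]
  | y, l :: w => by
    have ih := tsum_revWord V₀ A (y + l.vec) w
    rw [revWord_cons, disp_cons, ← add_assoc, tsum_append, ih, hol_revWord, disp_revWord, add_neg_cancel_right,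
      tsum_cons, tsum_nil, conjR_zero, add_zero, tstep_rev, hol_cons, tsum_cons, mul_inv_rev, conjR_mul_left,
      conjR_add, ← conjR_mul_left ((stepHol V₀ y l)⁻¹) (stepHol V₀ y l), inv_mul_cancel, conjR_one_left, conjR_neg,
      conjR_add, neg_add]
    abel

end Reversed

/-! ## §2 (115): the loop functional `A_x^{(1)}` split into its four pieces -/

section LoopSplit

omit [NormedAlgebra ℂ 𝔸] [NormOneClass 𝔸] [CompleteSpace 𝔸] in
/-- the loop holonomy factorised: `V₀(Γ_{c,x}) = V₀(Γ_{c₋,x})·V₀([x,x′])·V₀(Γ_{c₊,x′})⁻¹`. [cite: Balaban1985Averaging, (14) p.19, (42) p.23] -/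
theorem hol_gammaWord_eq (V₀ : Site d → Fin d → 𝔸ˣ) (q : Site d) (κ : Fin d) (r : Fin d → Fin L) :
    hol V₀ q (gammaWord L κ (boxVec L r))
      = hol V₀ q (treeWord (boxVec L r)) * hol V₀ (q + boxVec L r) (seg κ L)
        * (hol V₀ (q + (L : ℤ) • e κ) (treeWord (boxVec L r)))⁻¹ := by
  rw [gammaWord, hol_append, hol_append, disp_append, disp_treeWord, disp_seg,
    hol_revWord' V₀ (x := q + (L : ℤ) • e κ) _ (treeWord (boxVec L r)) (by rw [disp_treeWord]; abel)]

omit [NormedAlgebra ℂ 𝔸] [NormOneClass 𝔸] [CompleteSpace 𝔸] in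
/-- **(115), exactly**: "A_x = (R_{0,c₋}A)(Γ_{c₋,x}∪[x, x′]) − R(e^{iY_x})(R_{0,c₋}A)(c∪Γ_{c₊,x′})" — for the first-order
functional: `A_x^{(1)} = (R_{0,c₋}A)(Γ_{c₋,x}) + R(V₀(Γ_{c₋,x}))(R_{0,x}A)([x,x′]) − R(V₀(Γ_{c,x}))(R_{0,c₊}A)(Γ_{c₊,x′})
− R(W_x)(R_{0,c₋}A)(c)`, where `W_x = V₀(Γ_{c,x})V₀(c)⁻¹ = e^{iY_x}` and `V₀(Γ_{c,x}) = W_x V₀(c)` (so the last two terms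
are `−R(e^{iY_x})(R_{0,c₋}A)(c ∪ Γ_{c₊,x′})`). [cite: Balaban1985Averaging, (115) p.34] -/
theorem Aloop_eq (V₀ : Site d → Fin d → 𝔸ˣ) (A : Site d → Fin d → 𝔸) (q : Site d) (κ : Fin d) (r : Fin d → Fin L) :
    Aloop L V₀ A q κ (boxVec L r)
      = tsum V₀ A q (treeWord (boxVec L r))
        + conjR (hol V₀ q (treeWord (boxVec L r))) (tsum V₀ A (q + boxVec L r) (seg κ L))
        - conjR (hol V₀ q (gammaWord L κ (boxVec L r))) (tsum V₀ A (q + (L : ℤ) • e κ) (treeWord (boxVec L r)))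
        - conjR (Wcx L V₀ q κ (boxVec L r)) (tsum V₀ A q (seg κ L)) := by
  -- the returning straight segment `−c` from `c₊`
  have hseg : tsum V₀ A (q + (L : ℤ) • e κ) (seg κ (-(L : ℤ)))
      = -conjR ((hol V₀ q (seg κ L))⁻¹) (tsum V₀ A q (seg κ L)) := by
    rw [← revWord_seg, ← disp_seg κ (L : ℤ), tsum_revWord]
  -- the returning tree contour `−Γ_{c₊,x′}` from `x′`
  have htw : tsum V₀ A (q + (boxVec L r + (L : ℤ) • e κ)) (revWord (treeWord (boxVec L r)))
      = -conjR ((hol V₀ (q + (L : ℤ) • e κ) (treeWord (boxVec L r)))⁻¹)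
          (tsum V₀ A (q + (L : ℤ) • e κ) (treeWord (boxVec L r))) := by
    have h := tsum_revWord V₀ A (q + (L : ℤ) • e κ) (treeWord (boxVec L r))
    rw [disp_treeWord] at h
    rw [show q + (boxVec L r + (L : ℤ) • e κ) = q + (L : ℤ) • e κ + boxVec L r by abel]
    exact h
  -- `Γ_{c,x} ∪ (−c) = ((Γ_{c₋,x} ∪ [x,x′]) ∪ (−Γ_{c₊,x′})) ∪ (−c)`
  have h1 : Aloop L V₀ A q κ (boxVec L r)
      = tsum V₀ A q (gammaWord L κ (boxVec L r))
        + conjR (hol V₀ q (gammaWord L κ (boxVec L r))) (tsum V₀ A (q + (L : ℤ) • e κ) (seg κ (-(L : ℤ)))) := by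
    rw [Aloop, tsum_append, disp_gammaWord]
  have h2 : tsum V₀ A q (gammaWord L κ (boxVec L r))
      = tsum V₀ A q (treeWord (boxVec L r))
        + conjR (hol V₀ q (treeWord (boxVec L r))) (tsum V₀ A (q + boxVec L r) (seg κ L))
        + conjR (hol V₀ q (treeWord (boxVec L r)) * hol V₀ (q + boxVec L r) (seg κ L))
            (tsum V₀ A (q + (boxVec L r + (L : ℤ) • e κ)) (revWord (treeWord (boxVec L r)))) := by
    rw [gammaWord, tsum_append, tsum_append, disp_append, disp_treeWord, disp_seg, hol_append, disp_treeWord]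
  rw [h1, h2, htw, hseg, conjR_neg, conjR_neg, ← conjR_mul_left, ← conjR_mul_left, ← hol_gammaWord_eq, Wcx,
    sub_eq_add_neg, sub_eq_add_neg]

end LoopSplit

/-! ## §3 (124), REGROUPED: the linear part = the main term (125) + three defect brackets -/

section Split

omit [NormOneClass 𝔸] [CompleteSpace 𝔸] in
/-- `Σ_{x∈B(c₋)} L^{−d}·Z = Z` (the block has `L^d` sites). [cite: Balaban1985Averaging, (2) p.17, (42) p.23] -/
theorem sum_blockWeight (hL : 1 ≤ L) (Z : 𝔸) : ∑ _r : Fin d → Fin L, (((L : ℝ) ^ d)⁻¹) • Z = Z := by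
  rw [Finset.sum_const, Finset.card_univ, Fintype.card_pi, Finset.prod_const, Finset.card_univ, Fintype.card_fin,
    Fintype.card_fin, ← Nat.cast_smul_eq_nsmul ℝ, smul_smul, Nat.cast_pow]
  have hL0 : ((L : ℝ) ^ d) ≠ 0 := by positivity
  rw [mul_inv_cancel₀ hL0, one_smul]

omit [NormedAlgebra ℂ 𝔸] [NormOneClass 𝔸] [CompleteSpace 𝔸] in
/-- `R(X)` through a finite sum. [cite: Balaban1985Averaging, (56) p.27] -/
theorem conjR_sum {ι : Type*} (s : Finset ι) (X : 𝔸ˣ) (f : ι → 𝔸) :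
    conjR X (∑ i ∈ s, f i) = ∑ i ∈ s, conjR X (f i) := by
  simp only [conjR_apply, Finset.mul_sum, Finset.sum_mul]

omit [NormOneClass 𝔸] [CompleteSpace 𝔸] in
/-- the main term of the splitting: `Σ_x L^{−d} R(V₀(Γ_{c₋,x}))(R_{0,x}A)([x,x′]) = L·(Q₀A)_c`. [cite: Balaban1985Averaging, (124)–(125) p.36] -/
theorem sum_mainTerm (hL : 1 ≤ L) (V₀ : Site d → Fin d → 𝔸ˣ) (A : Site d → Fin d → 𝔸) (q : Site d) (κ : Fin d) :
    ∑ r : Fin d → Fin L, (((L : ℝ) ^ d)⁻¹) •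
        conjR (hol V₀ q (treeWord (boxVec L r))) (tsum V₀ A (q + boxVec L r) (seg κ L))
      = (L : ℝ) • Q0cov L V₀ A q κ := by
  unfold Q0cov
  rw [Finset.smul_sum]
  refine Finset.sum_congr rfl fun r _ => ?_
  rw [smul_smul]
  congr 1
  have hL0 : (L : ℝ) ≠ 0 := by exact_mod_cast (by omega : L ≠ 0)
  rw [pow_succ]
  field_simp

omit [NormOneClass 𝔸] in
/-- `R̄_{0,c} = R(e^{X₀})∘R(V₀(c))` on the algebra: `(V̄₀)_c = e^{X_c(V₀)}V₀(c)` ((42)). [cite: Balaban1985Averaging, (42) p.23, (59) p.27] -/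
theorem conjR_bavg (V₀ : Site d → Fin d → 𝔸ˣ) (q : Site d) (κ : Fin d) (Z : 𝔸) :
    conjR (bavg L V₀ q κ) Z = conjR (expUnit (Xavg L V₀ q κ)) (conjR (hol V₀ q (seg κ L)) Z) := by
  rw [show bavg L V₀ q κ = expUnit (Xavg L V₀ q κ) * hol V₀ q (seg κ L) from rfl, conjR_mul_left]

omit [NormedAlgebra ℂ 𝔸] [NormOneClass 𝔸] [CompleteSpace 𝔸] in
/-- `R(V₀(Γ_{c,x})) = R(W_x)∘R(V₀(c))`: `V₀(Γ_{c,x}) = W_x·V₀(c)`. [cite: Balaban1985Averaging, (42) p.23, (114) p.34] -/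
theorem conjR_gammaWord (V₀ : Site d → Fin d → 𝔸ˣ) (q : Site d) (κ : Fin d) (r : Site d) (Z : 𝔸) :
    conjR (hol V₀ q (gammaWord L κ r)) Z = conjR (Wcx L V₀ q κ r) (conjR (hol V₀ q (seg κ L)) Z) := by
  rw [← conjR_mul_left, Wcx, inv_mul_cancel_right]

omit [NormOneClass 𝔸] [CompleteSpace 𝔸] in
/-- **(115) summed over the block**: `Σ_x L^{−d}A_x^{(1)} = F̂_{V₀}(c₋) + L·(Q₀A)_c − Σ_x L^{−d}R(W_x)R(V₀(c))(R_{0,c₊}A)(Γ_{c₊,x′})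
− Σ_x L^{−d}R(W_x)(R_{0,c₋}A)(c)` — the tree-contour terms `(R_{0,c₋}A)(Γ_{c₋,x})` ARE the frame exponent `F̂_{V₀}(c₋)` and
the segment terms ARE the main term. [cite: Balaban1985Averaging, (115) p.34, (120) p.35, (124)–(125) p.36] -/
theorem sum_Aloop_eq (hL : 1 ≤ L) (V₀ : Site d → Fin d → 𝔸ˣ) (A : Site d → Fin d → 𝔸) (q : Site d) (κ : Fin d) :
    ∑ r : Fin d → Fin L, (((L : ℝ) ^ d)⁻¹) • Aloop L V₀ A q κ (boxVec L r)
      = FhatCov L V₀ A q + (L : ℝ) • Q0cov L V₀ A q κ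
        - ∑ r : Fin d → Fin L, (((L : ℝ) ^ d)⁻¹) •
            conjR (Wcx L V₀ q κ (boxVec L r))
              (conjR (hol V₀ q (seg κ L)) (tsum V₀ A (q + (L : ℤ) • e κ) (treeWord (boxVec L r))))
        - ∑ r : Fin d → Fin L, (((L : ℝ) ^ d)⁻¹) • conjR (Wcx L V₀ q κ (boxVec L r)) (tsum V₀ A q (seg κ L)) := by
  rw [FhatCov, ← sum_mainTerm L hL, ← Finset.sum_add_distrib, ← Finset.sum_sub_distrib, ← Finset.sum_sub_distrib]
  refine Finset.sum_congr rfl fun r _ => ?_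
  rw [Aloop_eq, conjR_gammaWord, smul_sub, smul_sub, smul_add]

omit [NormOneClass 𝔸] in
/-- the third frame term: `R̄_{0,c}F̂_{V₀}(c₊) = Σ_{x′} L^{−d}R(e^{X₀})R(V₀(c))(R_{0,c₊}A)(Γ_{c₊,x′})`. [cite: Balaban1985Averaging, (120) p.35] -/
theorem conjR_bavg_FhatCov (V₀ : Site d → Fin d → 𝔸ˣ) (A : Site d → Fin d → 𝔸) (q : Site d) (κ : Fin d) :
    conjR (bavg L V₀ q κ) (FhatCov L V₀ A (q + (L : ℤ) • e κ))
      = ∑ r : Fin d → Fin L, (((L : ℝ) ^ d)⁻¹) •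
          conjR (expUnit (Xavg L V₀ q κ))
            (conjR (hol V₀ q (seg κ L)) (tsum V₀ A (q + (L : ℤ) • e κ) (treeWord (boxVec L r)))) := by
  rw [FhatCov, conjR_sum]
  refine Finset.sum_congr rfl fun r _ => ?_
  rw [conjR_smul_real, conjR_bavg]

/-- **(124), REGROUPED — THE LINEAR PART SPLIT INTO THE MAIN TERM (125) AND THREE DEFECT BRACKETS.**  Under the small-field
condition `‖W_x(V₀) − 1‖ < 1` on `B(c₋)` (for `linQcov_eq`), with `X₀ = X_c(V₀)` (`= iY`), `W_x` (`= e^{iY_x}`),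
`Ψ_x(Z) := (D log)_{W_x}(Z W_x)` (`= g⁻¹(−i ad_{Y_x})`, inside `DXavg`), `Φ := (D exp)_{X₀}(·)e^{−X₀}` (`= g(−i ad_Y)`,
`PhiY`), `𝒜 := R(e^{X₀})` (`= e^{i ad_Y}`):
`L(Q(V₀)A)_c = L·(Q₀A)_c + [Φ(Σ_x L^{−d}Ψ_x(A_x^{(1)})) − Σ_x L^{−d}A_x^{(1)}] + [𝒜 − Σ_x L^{−d}R(W_x)]((R_{0,c₋}A)(c))
+ Σ_{x′} L^{−d}[𝒜 − R(W_x)]R(V₀(c))(R_{0,c₊}A)(Γ_{c₊,x′})` — print's four remainder terms of (124), each an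
`[operator − 1]` acting on a path sum (the brackets vanish when `Ψ_x = Φ = 𝒜 = R(W_x) = 1`, i.e. at flat loops), obtained
from the closed form (120) (`B7Prop3GeneralTild.linQcov_eq`) by (115) (`sum_Aloop_eq`: the tree-contour terms
`(R_{0,c₋}A)(Γ_{c₋,x})` CANCEL against the frame `−F̂_{V₀}(c₋)`, as at the flat background `B7Prop3Flat.frame_cancellation`),
`R̄_{0,c} = 𝒜∘R(V₀(c))` and `R(V₀(Γ_{c,x})) = R(W_x)∘R(V₀(c))`. [cite: Balaban1985Averaging, (124) p.36, (120) p.35, (115) p.34] -/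
theorem linQcov_split (hL : 1 ≤ L) (V₀ : Site d → Fin d → 𝔸ˣ) (A : Site d → Fin d → 𝔸) (q : Site d) (κ : Fin d)
    (hW : ∀ r : Fin d → Fin L, ‖((Wcx L V₀ q κ (boxVec L r) : 𝔸ˣ) : 𝔸) - 1‖ < 1) :
    linQcov L V₀ A q κ
      = (L : ℝ) • Q0cov L V₀ A q κ
        + (PhiY (Xavg L V₀ q κ) (DXavg L V₀ A q κ)
            - ∑ r : Fin d → Fin L, (((L : ℝ) ^ d)⁻¹) • Aloop L V₀ A q κ (boxVec L r))
        + (conjR (expUnit (Xavg L V₀ q κ)) (tsum V₀ A q (seg κ L))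
            - ∑ r : Fin d → Fin L, (((L : ℝ) ^ d)⁻¹) • conjR (Wcx L V₀ q κ (boxVec L r)) (tsum V₀ A q (seg κ L)))
        + ∑ r : Fin d → Fin L, (((L : ℝ) ^ d)⁻¹) •
            (conjR (expUnit (Xavg L V₀ q κ))
                (conjR (hol V₀ q (seg κ L)) (tsum V₀ A (q + (L : ℤ) • e κ) (treeWord (boxVec L r))))
              - conjR (Wcx L V₀ q κ (boxVec L r))
                (conjR (hol V₀ q (seg κ L)) (tsum V₀ A (q + (L : ℤ) • e κ) (treeWord (boxVec L r))))) := by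
  rw [linQcov_eq L V₀ A q κ hW, QprimeCov, conjR_bavg_FhatCov, sum_Aloop_eq L hL]
  simp only [smul_sub, Finset.sum_sub_distrib]
  abel

end Split

end Literature.MathematicalPhysics.QuantumFieldTheory.Balaban1983to89.B7Prop3GeneralLinearSplit

end
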